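/-
Copyright (c) 2026 the pub-hodgecm-mathlib formalisation cell (harness21).  Prover seat hodgecm-mathlib-LH4-p13 (g0): Track A «(D-RAM) FOUR-FRAME» squad of crux H413
(dealer LH4-plan (g10) WORD #29 «p13 → (e) `stub_U2H_typeTwoRow_wild`»; the type-(2) half of the (b′-2)∕(e) dictionary), 2026-09-03.
-/
import Literature.NumberTheory.Automorphic.SLTwoTreeQuadraticTorusNormalForm            -- ★ p855546 (this seat): torus normal form; brings `IsUniformizingElement`, the datum vocabulary
import Literature.NumberTheory.Automorphic.ValuedFieldValuativeRelBridge                -- ★ `valuedInteger_eq_integer` (the `Valued` and `ValuativeRel` valuation rings coincide)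
import Literature.NumberTheory.Automorphic.GodementJacquetLemma610Bounded               -- ★ `exists_valuation_eq_pow` (`|x| = |ϖ|^m` for `x ∈ 𝒪 ∖ 0`)
import Mathlib.RingTheory.Henselian
import HarnessLib

/-!
# Every non-square `D` of a Henselian discretely valued field has an INERT or EISENSTEIN datum: `D = (u² + 4w)·z²` with `τ² = uτ + w` generating the maximal order of
# `F(√D)` — `(u, w)` inert (norm form anisotropic mod `𝔭`) or Eisenstein (`|u| < 1`, `|w| = |ϖ|`) — ANY residue characteristic (Serre, *Local Fields* I §6, III §5)

Topic `NumberTheory/Automorphic`; namespace `Literature.NumberTheory.Automorphic.HermitianLatticeTree`.  THEOREMS ONLY (no definition, no instance, no notation, no named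
fact, no `sorry`); kernel lane `--supports stmt-HodgeConjecture-24833`.  Cell `pub/hodgecm-mathlib` (D-0151), crux H413; Track A «(D-RAM) FOUR-FRAME», unit U2H (ii-H), child
(e) `stub_U2H_typeTwoRow_wild`: the TYPE-(2) half of the dictionary — the eigen-field `K_g = L⁺_v(√D)`, `D = tr²g − 4 det g`, of a type-(2) element is NOT `L_w`, so ★
`exists_eisensteinBasis_of_ramified` does not supply its datum; this file supplies one for EVERY non-square `D`, at a dyadic place too (where the unramified extension is
`τ² = τ + c`, not `τ² = ε₀`, and several ramified ones occur).  Consumers: ★ `exists_torusForm_binders_of_inert∕eisenstein_of_deep` (p855546) → ★ p855257 ∕ ★ p855511.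
HONEST LABEL: HC_CM is proved only modulo the 7 printed citations (2 remaining named inputs: hLiu418 = stmt-HodgeConjecture-24832, h413 = stmt-HodgeConjecture-24833) until
rung 0 closes; nothing printed is asserted here — local algebra.

THE MATHEMATICS (the classical construction of the ring of integers of a quadratic extension, phrased inside `F`).  Normalise `|D| ∈ {1, |ϖ|}` by a square.  If `|D| = |ϖ|`,
`(u, w, z) = (0, D, 1∕2)` is Eisenstein.  If `|D| = 1`, let `m` be MAXIMAL with `∃ a ∈ 𝒪: |2a| ≤ |ϖ|^m, |a² − D| ≤ |ϖ|^{2m}` (`m ≤ v(2)`; `m = 0` works with `a = 0`), and put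
`u = 2a∕ϖ^m`, `w = (D − a²)∕ϖ^{2m}` — the trace and minus the norm of `τ = (a + √D)∕ϖ^m`, so `u² + 4w = 4D∕ϖ^{2m}`.  If `X² − uX − w` has no approximate root in `𝒪`, the norm
form `c² + ceu − e²w` is anisotropic mod `𝔭` (INERT).  An approximate root `r` with `|2r − u| = 1` lifts by HENSEL to a root, making `D` a square — excluded.  An approximate
root with `|2r − u| < 1`: shifting `τ ↦ τ − r` gives `(u₁, w₁) = (u − 2r, w + ur − r²)` with the same `u² + 4w`, `|u₁| < 1`, `|w₁| < 1`; `|w₁| ≤ |ϖ|²` would give the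
witness `a − ϖ^m r` for `m + 1`, so `|w₁| = |ϖ|`: EISENSTEIN.  No finiteness or perfectness of the residue field is used; `(2 : F) ≠ 0` is «characteristic `≠ 2`».

* §1 helpers: `valuation_le_uniformizer_of_lt_one`, `valuation_eq_uniformizer_of_lt_one_of_sq_lt`, `exists_mul_sq_valuation_normalised` (over ★ `exists_valuation_eq_pow`).
* §2 the unit case: `hanis_of_forall_valuation_ge_one` (no approximate root ⟹ inert), `isSquare_of_approxRoot_of_valuation_eq_one` (Hensel), **`exists_datum_of_valuation_eq_one`**.
* §3 **`exists_inert_or_eisenstein_datum`** (any non-square `D ≠ 0`); §4 `henselianLocalRing_integer_adicCompletion` (the instance for `L⁺_v`, via ★ `valuedInteger_eq_integer`).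

## References
* [Serre1979] J.-P. Serre, *Local Fields*, GTM 67 (1979), Ch. I §6 Prop. 17–18 (totally ramified extensions and Eisenstein equations), Ch. III §5 Thm. 3 (unramified
  extensions), Ch. II §3 (Hensel).
* [LabesseLanglands1979] J.-P. Labesse, R. P. Langlands, *L-indistinguishability for SL(2)*, Canad. J. Math. 31 (1979), §2 pp. 7–8 (the quadratic tori of `GL₂`).
-/

set_option autoImplicit false

noncomputable section

open scoped ValuativeRel
open ValuativeRel Polynomial

namespace Literature.NumberTheory.Automorphic.HermitianLatticeTree

open Literature.NumberTheory.Automorphic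

/-! ## §1 Valuation helpers in a discretely valued field -/

section Helpers

variable {F : Type*} [Field F] [ValuativeRel F] {ϖ : F}

/-- `|x| < 1`, `x ∈ 𝒪` ⟹ `|x| ≤ |ϖ|` for a uniformizing element `ϖ` (the maximal ideal is `ϖ𝒪`). [cite: Serre1979, Ch. I §1] -/
theorem valuation_le_uniformizer_of_lt_one (hϖ : IsUniformizingElement ϖ) {x : F} (hx : x ∈ 𝒪[F]) (hlt : valuation F x < 1) :
    valuation F x ≤ valuation F ϖ := by
  obtain ⟨y, hy, rfl⟩ := hϖ.exists_eq_mul hx hlt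
  rw [map_mul]
  exact mul_le_of_le_one_right' ((Valuation.mem_integer_iff _ _).1 hy)

/-- `|ϖ|² < |x| < 1` with `x ∈ 𝒪` forces `|x| = |ϖ|` (the value group is `|ϖ|^ℤ`). [cite: Serre1979, Ch. I §1] -/
theorem valuation_eq_uniformizer_of_lt_one_of_sq_lt [IsDiscreteValuationRing 𝒪[F]] (hϖ : IsUniformizingElement ϖ) {x : F} (hx : x ∈ 𝒪[F])
    (hlt : valuation F x < 1) (hgt : valuation F ϖ ^ 2 < valuation F x) : valuation F x = valuation F ϖ := by
  have hx0 : x ≠ 0 := fun h => by rw [h, map_zero] at hgt; exact not_lt_of_ge zero_le hgt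
  obtain ⟨m, hm⟩ := exists_valuation_eq_pow hϖ hx hx0
  have hϖ0 : 0 < valuation F ϖ := (Valuation.pos_iff _).2 hϖ.ne_zero
  have hanti : StrictAnti (fun n : ℕ => valuation F ϖ ^ n) := pow_right_strictAnti₀ hϖ0 hϖ.valuation_lt_one
  rw [hm] at hlt hgt ⊢
  have hm1 : 1 ≤ m := by
    by_contra h
    rw [not_le, Nat.lt_one_iff] at h
    rw [h, pow_zero] at hlt
    exact lt_irrefl _ hlt
  have hm2 : m < 2 := (StrictAnti.lt_iff_gt hanti).1 hgt
  have : m = 1 := by omega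
  rw [this, pow_one]

/-- **NORMALISING A NON-ZERO ELEMENT BY A SQUARE**: `|D·c²| = 1` or `|D·c²| = |ϖ|` for some `c ≠ 0` (`|D| = |ϖ|^n`, `n ∈ ℤ`; take `c = ϖ^{−⌊n∕2⌋}`) — the square classes of
`F^×` have representatives of valuation `0` or `1`. [cite: Serre1979, Ch. I §1; Ch. XIV §4] -/
theorem exists_mul_sq_valuation_normalised [IsDiscreteValuationRing 𝒪[F]] (hϖ : IsUniformizingElement ϖ) {D : F} (hD0 : D ≠ 0) :
    ∃ c : F, c ≠ 0 ∧ (valuation F (D * c ^ 2) = 1 ∨ valuation F (D * c ^ 2) = valuation F ϖ) := by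
  have hϖ0 : ϖ ≠ 0 := hϖ.ne_zero
  have hvϖ0 : valuation F ϖ ≠ 0 := (Valuation.ne_zero_iff _).2 hϖ0
  have hpow0 : ∀ k : ℕ, (valuation F ϖ ^ k) ^ 2 ≠ 0 := fun k => pow_ne_zero _ (pow_ne_zero _ hvϖ0)
  by_cases hD : D ∈ 𝒪[F]
  · obtain ⟨n, hn⟩ := exists_valuation_eq_pow hϖ hD hD0
    obtain ⟨k, hk | hk⟩ := Nat.even_or_odd' n
    · refine ⟨(ϖ ^ k)⁻¹, inv_ne_zero (pow_ne_zero _ hϖ0), Or.inl ?_⟩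
      rw [map_mul, map_pow, map_inv₀, map_pow, hn, hk, mul_comm 2 k, pow_mul, inv_pow, mul_inv_cancel₀ (hpow0 k)]
    · refine ⟨(ϖ ^ k)⁻¹, inv_ne_zero (pow_ne_zero _ hϖ0), Or.inr ?_⟩
      rw [map_mul, map_pow, map_inv₀, map_pow, hn, hk, pow_succ, mul_comm 2 k, pow_mul, inv_pow, mul_right_comm, mul_inv_cancel₀ (hpow0 k), one_mul]
  · -- `D⁻¹ ∈ 𝒪` with `|D⁻¹| = |ϖ|^n`
    have hDgt : 1 < valuation F D := by rw [Valuation.mem_integer_iff, not_le] at hD; exact hD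
    have hDinv : D⁻¹ ∈ 𝒪[F] := by
      rw [Valuation.mem_integer_iff, map_inv₀]
      exact ((inv_lt_one₀ (lt_trans zero_lt_one hDgt)).2 hDgt).le
    obtain ⟨n, hn⟩ := exists_valuation_eq_pow hϖ hDinv (inv_ne_zero hD0)
    rw [map_inv₀] at hn
    have hDv : valuation F D = (valuation F ϖ ^ n)⁻¹ := by rw [← hn, inv_inv]
    obtain ⟨k, hk | hk⟩ := Nat.even_or_odd' n
    · refine ⟨ϖ ^ k, pow_ne_zero _ hϖ0, Or.inl ?_⟩
      rw [map_mul, map_pow, map_pow, hDv, hk, mul_comm 2 k, pow_mul, inv_mul_cancel₀ (hpow0 k)]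
    · refine ⟨ϖ ^ (k + 1), pow_ne_zero _ hϖ0, Or.inr ?_⟩
      rw [map_mul, map_pow, map_pow, hDv, hk, ← pow_mul, show (k + 1) * 2 = (2 * k + 1) + 1 by ring, pow_succ (valuation F ϖ) (2 * k + 1),
        ← mul_assoc, inv_mul_cancel₀ (pow_ne_zero _ hvϖ0), one_mul]

end Helpers

/-! ## §2 The unit case `|D| = 1`: maximal `m`, then inert, or (after a shift) Eisenstein; Hensel excludes the simple-root case -/

section UnitCase

variable {F : Type*} [Field F] [ValuativeRel F] {ϖ : F}

/-- **NO APPROXIMATE ROOT ⟹ INERT**: if no `r ∈ 𝒪` has `|r² − ur − w| < 1` (`u w ∈ 𝒪`), then the norm form `c² + ceu − e²w` of `τ² = uτ + w` is anisotropic modulo `𝔭`: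
`|c² + ceu − e²w| < 1` with `c e ∈ 𝒪` forces `|c| < 1` and `|e| < 1` (a unit `e` would make `−c∕e` an approximate root). [cite: Serre1979, Ch. III §5 Thm. 3] -/
theorem hanis_of_forall_valuation_ge_one {u w : F} (hu : u ∈ 𝒪[F]) (hw : w ∈ 𝒪[F])
    (hno : ∀ r : F, r ∈ 𝒪[F] → 1 ≤ valuation F (r ^ 2 - u * r - w)) :
    ∀ c e : F, c ∈ 𝒪[F] → e ∈ 𝒪[F] → valuation F (c ^ 2 + c * e * u - e ^ 2 * w) < 1 → valuation F c < 1 ∧ valuation F e < 1 := by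
  intro c e hc he hlt
  have hc1 : valuation F c ≤ 1 := (Valuation.mem_integer_iff _ _).1 hc
  have he1 : valuation F e ≤ 1 := (Valuation.mem_integer_iff _ _).1 he
  -- `|e| < 1`: otherwise `r = −c∕e` is an approximate root
  have he' : valuation F e < 1 := by
    by_contra hge
    rw [not_lt] at hge
    have heq : valuation F e = 1 := le_antisymm he1 hge
    have he0 : e ≠ 0 := fun h => by rw [h, map_zero] at heq; exact zero_ne_one heq
    have hr : -c / e ∈ 𝒪[F] := by
      rw [Valuation.mem_integer_iff, Valuation.map_div, Valuation.map_neg, heq, div_one]; exact hc1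
    have h1 := hno (-c / e) hr
    have hid : (-c / e) ^ 2 - u * (-c / e) - w = (c ^ 2 + c * e * u - e ^ 2 * w) / e ^ 2 := by field_simp; ring
    rw [hid, Valuation.map_div, Valuation.map_pow, heq, one_pow, div_one] at h1
    exact absurd hlt (not_lt_of_ge h1)
  refine ⟨?_, he'⟩
  -- `|c²| < 1` since `c² = N − ceu + e²w` with every term of valuation `< 1`
  have hceu : valuation F (c * e * u) < 1 := by
    rw [map_mul, map_mul]
    calc valuation F c * valuation F e * valuation F u ≤ 1 * valuation F e * 1 :=
          mul_le_mul' (mul_le_mul' hc1 le_rfl) ((Valuation.mem_integer_iff _ _).1 hu)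
      _ = valuation F e := by rw [one_mul, mul_one]
      _ < 1 := he'
  have he2w : valuation F (e ^ 2 * w) < 1 := by
    rw [map_mul, map_pow]
    calc valuation F e ^ 2 * valuation F w ≤ valuation F e ^ 2 * 1 := mul_le_mul' le_rfl ((Valuation.mem_integer_iff _ _).1 hw)
      _ = valuation F e * valuation F e := by rw [mul_one, pow_two]
      _ < 1 := by
          calc valuation F e * valuation F e ≤ valuation F e * 1 := mul_le_mul' le_rfl he1
            _ = valuation F e := mul_one _
            _ < 1 := he'
  have hc2 : valuation F (c ^ 2) < 1 := by
    have : c ^ 2 = (c ^ 2 + c * e * u - e ^ 2 * w) - c * e * u + e ^ 2 * w := by ring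
    rw [this]
    refine lt_of_le_of_lt (Valuation.map_add _ _ _) (max_lt (lt_of_le_of_lt (Valuation.map_sub _ _ _) (max_lt hlt hceu)) he2w)
  by_contra hge
  rw [not_lt] at hge
  have hceq : valuation F c = 1 := le_antisymm hc1 hge
  rw [map_pow, hceq, one_pow] at hc2
  exact lt_irrefl _ hc2

/-- **A SIMPLE APPROXIMATE ROOT MAKES `D` A SQUARE (Hensel)**: if `u w ∈ 𝒪`, `u² + 4w = 4D∕ϖ^{2m}` (i.e. `(u² + 4w)·ϖ^{2m} = 4D`), and some `r ∈ 𝒪` has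
`|r² − ur − w| < 1` and `|2r − u| = 1`, then `X² − uX − w` has a root `ρ ∈ 𝒪` (Hensel's lemma in the Henselian ring `𝒪`) and `D = ((2ρ − u)ϖ^m∕2)²`.
[cite: Serre1979, Ch. II §3] -/
theorem isSquare_of_approxRoot_of_valuation_eq_one [HenselianLocalRing 𝒪[F]] (h2 : (2 : F) ≠ 0) {u w D : F} {m : ℕ} (hu : u ∈ 𝒪[F]) (hw : w ∈ 𝒪[F])
    (huw : (u ^ 2 + 4 * w) * ϖ ^ (2 * m) = 4 * D) {r : F} (hr : r ∈ 𝒪[F]) (hroot : valuation F (r ^ 2 - u * r - w) < 1)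
    (hsimple : valuation F (2 * r - u) = 1) : IsSquare D := by
  -- the monic polynomial `X² − uX − w` over `𝒪`
  set f : 𝒪[F][X] := X ^ 2 - (C (⟨u, hu⟩ : 𝒪[F]) * X + C (⟨w, hw⟩ : 𝒪[F])) with hf
  have hmonic : f.Monic := by
    rw [hf]
    exact (monic_X_pow 2).sub_of_left (lt_of_le_of_lt degree_linear_le (by rw [degree_X_pow]; norm_num))
  have heval : ∀ s : 𝒪[F], (f.eval s).val = s.val ^ 2 - u * s.val - w := by
    intro s
    simp only [hf, eval_sub, eval_add, eval_pow, eval_X, eval_mul, eval_C]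
    push_cast
    ring
  have hderiv : ∀ s : 𝒪[F], (f.derivative.eval s).val = 2 * s.val - u := by
    intro s
    simp only [hf, derivative_sub, derivative_add, derivative_X_pow, derivative_mul, derivative_C, derivative_X, zero_mul, mul_one, zero_add,
      add_zero, eval_sub, eval_mul, eval_C, eval_X, pow_one, Nat.cast_ofNat, Nat.add_one_sub_one]
    push_cast
    rw [show ((2 : 𝒪[F]) : F) = 2 from rfl]
  -- Hensel's hypotheses at `r`
  have hmax : f.eval ⟨r, hr⟩ ∈ IsLocalRing.maximalIdeal 𝒪[F] := by
    rw [IsLocalRing.mem_maximalIdeal, mem_nonunits_iff, (Valuation.integer.integers (valuation F)).isUnit_iff_valuation_eq_one]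
    intro h1
    have h1' : valuation F (f.eval ⟨r, hr⟩).val = 1 := h1
    rw [heval] at h1'
    rw [h1'] at hroot
    exact lt_irrefl _ hroot
  have hunit : IsUnit (f.derivative.eval ⟨r, hr⟩) := by
    rw [(Valuation.integer.integers (valuation F)).isUnit_iff_valuation_eq_one]
    show valuation F (f.derivative.eval ⟨r, hr⟩).val = 1
    rw [hderiv]
    exact hsimple
  obtain ⟨ρ, hρ, -⟩ := HenselianLocalRing.is_henselian f hmonic ⟨r, hr⟩ hmax hunit
  -- `ρ² = uρ + w`, hence `(2ρ − u)² = u² + 4w` and `D = ((2ρ − u)ϖ^m∕2)²`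
  have hρF : ρ.val ^ 2 - u * ρ.val - w = 0 := by
    rw [← heval ρ, show f.eval ρ = 0 from hρ]; rfl
  refine ⟨(2 * ρ.val - u) * ϖ ^ m / 2, ?_⟩
  have h4 : (4 : F) ≠ 0 := by rw [show (4 : F) = 2 * 2 by norm_num]; exact mul_ne_zero h2 h2
  have hsq : (2 * ρ.val - u) ^ 2 = u ^ 2 + 4 * w := by
    have : ρ.val ^ 2 = u * ρ.val + w := by linear_combination hρF
    linear_combination 4 * this
  have hD : D = (u ^ 2 + 4 * w) * ϖ ^ (2 * m) / 4 := by rw [huw]; field_simp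
  rw [hD, ← hsq]
  field_simp
  ring

/-- **THE UNIT CASE**: for `D ∈ 𝒪` with `|D| = 1` which is not a square (`𝒪` a Henselian DVR with uniformizing element `ϖ`, `char F ≠ 2`), there is an inert or Eisenstein
datum `(u, w)` and `z ≠ 0` with `(u² + 4w)·z² = D` — by the MAXIMAL approximate-integer construction of the module docstring. [cite: Serre1979, Ch. I §6 Prop. 17; Ch. III §5 Thm. 3]
[cite: LabesseLanglands1979, §2 p. 8] -/
theorem exists_datum_of_valuation_eq_one [IsDiscreteValuationRing 𝒪[F]] [HenselianLocalRing 𝒪[F]] (h2 : (2 : F) ≠ 0) (hϖ : IsUniformizingElement ϖ)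
    {D : F} (hD1 : valuation F D = 1) (hns : ¬ IsSquare D) :
    ∃ u w z : F, z ≠ 0 ∧ (u ^ 2 + 4 * w) * z ^ 2 = D ∧ u ∈ 𝒪[F] ∧
      ((w ∈ 𝒪[F] ∧ ∀ c e : F, c ∈ 𝒪[F] → e ∈ 𝒪[F] → valuation F (c ^ 2 + c * e * u - e ^ 2 * w) < 1 → valuation F c < 1 ∧ valuation F e < 1) ∨
        (valuation F u < 1 ∧ valuation F w = valuation F ϖ)) := by
  classical
  have hϖ0 : ϖ ≠ 0 := hϖ.ne_zero
  have hvϖ0 : 0 < valuation F ϖ := (Valuation.pos_iff _).2 hϖ0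
  have hvϖ1 : valuation F ϖ < 1 := hϖ.valuation_lt_one
  have hanti : StrictAnti (fun n : ℕ => valuation F ϖ ^ n) := pow_right_strictAnti₀ hvϖ0 hvϖ1
  have hDint : D ∈ 𝒪[F] := by rw [Valuation.mem_integer_iff, hD1]
  have hD0 : D ≠ 0 := fun h => by rw [h, map_zero] at hD1; exact zero_ne_one hD1
  have h2int : (2 : F) ∈ 𝒪[F] := by
    have : (2 : F) = 1 + 1 := by norm_num
    rw [this]; exact Subring.add_mem _ (Subring.one_mem _) (Subring.one_mem _)
  obtain ⟨e₂, he₂⟩ := exists_valuation_eq_pow hϖ h2int h2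
  -- the predicate and its maximal witness
  let P : ℕ → Prop := fun m => ∃ a : F, a ∈ 𝒪[F] ∧ valuation F (2 * a) ≤ valuation F ϖ ^ m ∧ valuation F (a ^ 2 - D) ≤ valuation F ϖ ^ (2 * m)
  have hP0 : P 0 := ⟨0, Subring.zero_mem _, by rw [mul_zero, map_zero]; exact zero_le, by
    rw [zero_pow two_ne_zero, zero_sub, Valuation.map_neg, hD1, mul_zero, pow_zero]⟩
  have hbound : ∀ m, P m → m ≤ e₂ := by
    rintro m ⟨a, ha, h2a, haD⟩
    rcases Nat.eq_zero_or_pos m with rfl | hm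
    · exact Nat.zero_le _
    -- `|a² − D| < 1 = |D|` forces `|a| = 1`, then `|2| ≤ |ϖ|^m`
    have hlt : valuation F (a ^ 2 - D) < 1 := lt_of_le_of_lt haD ((hanti (show 0 < 2 * m by omega)).trans_eq (pow_zero _))
    have ha2 : valuation F (a ^ 2) = 1 := by
      have : a ^ 2 = (a ^ 2 - D) + D := by ring
      rw [this, Valuation.map_add_eq_of_lt_right _ (by rw [hD1]; exact hlt), hD1]
    have ha1 : valuation F a = 1 := by
      have ha_le : valuation F a ≤ 1 := (Valuation.mem_integer_iff _ _).1 ha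
      rcases ha_le.lt_or_eq with hlt' | heq
      · exfalso
        have hsq : valuation F (a ^ 2) < 1 := by
          rw [map_pow, pow_two]
          calc valuation F a * valuation F a ≤ valuation F a * 1 := mul_le_mul' le_rfl ha_le
            _ = valuation F a := mul_one _
            _ < 1 := hlt'
        rw [ha2] at hsq
        exact lt_irrefl _ hsq
      · exact heq
    rw [map_mul, ha1, mul_one, he₂] at h2a
    exact (StrictAnti.le_iff_ge hanti).1 h2a
  set m := Nat.findGreatest P e₂ with hmdef
  have hPm : P m := Nat.findGreatest_spec (Nat.zero_le e₂) hP0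
  have hmax : ¬ P (m + 1) := by
    intro hP
    have hle : m + 1 ≤ e₂ := hbound _ hP
    exact Nat.findGreatest_is_greatest (Nat.lt_succ_self m) hle hP
  obtain ⟨a, ha, h2a, haD⟩ := hPm
  -- the datum `u = 2a∕ϖ^m`, `w = (D − a²)∕ϖ^{2m}`
  have hϖm0 : ϖ ^ m ≠ 0 := pow_ne_zero _ hϖ0
  have hϖ2m0 : ϖ ^ (2 * m) ≠ 0 := pow_ne_zero _ hϖ0
  set u : F := 2 * a / ϖ ^ m with hudef
  set w : F := (D - a ^ 2) / ϖ ^ (2 * m) with hwdef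
  have hu : u ∈ 𝒪[F] := by
    rw [Valuation.mem_integer_iff, hudef, Valuation.map_div, Valuation.map_pow]
    exact div_le_one_of_le₀ h2a zero_le
  have hw : w ∈ 𝒪[F] := by
    rw [Valuation.mem_integer_iff, hwdef, Valuation.map_div, Valuation.map_pow, Valuation.map_sub_swap]
    exact div_le_one_of_le₀ haD zero_le
  have h2a' : 2 * a = u * ϖ ^ m := by rw [hudef]; field_simp
  have haD' : a ^ 2 - D = -(w * ϖ ^ (2 * m)) := by rw [hwdef]; field_simp; ring
  have huw : (u ^ 2 + 4 * w) * ϖ ^ (2 * m) = 4 * D := by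
    have : u ^ 2 * ϖ ^ (2 * m) = (u * ϖ ^ m) ^ 2 := by ring
    rw [add_mul, this, ← h2a']
    linear_combination 4 * haD'
  have hz : ϖ ^ m / 2 ≠ 0 := div_ne_zero hϖm0 h2
  have hmain : (u ^ 2 + 4 * w) * (ϖ ^ m / 2) ^ 2 = D := by
    have h4 : (4 : F) ≠ 0 := by rw [show (4 : F) = 2 * 2 by norm_num]; exact mul_ne_zero h2 h2
    have : (ϖ ^ m / 2) ^ 2 = ϖ ^ (2 * m) / 4 := by rw [div_pow, ← pow_mul, mul_comm m 2]; norm_num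
    rw [this, ← mul_div_assoc, huw]; field_simp
  -- dichotomy on approximate roots of `X² − uX − w`
  by_cases hex : ∃ r : F, r ∈ 𝒪[F] ∧ valuation F (r ^ 2 - u * r - w) < 1
  swap
  · exact ⟨u, w, ϖ ^ m / 2, hz, hmain, hu, Or.inl ⟨hw, hanis_of_forall_valuation_ge_one hu hw fun r hr => not_lt.1 fun hlt => hex ⟨r, hr, hlt⟩⟩⟩
  obtain ⟨r, hr, hroot⟩ := hex
  have hr1 : valuation F r ≤ 1 := (Valuation.mem_integer_iff _ _).1 hr
  have h2ru_int : 2 * r - u ∈ 𝒪[F] := Subring.sub_mem _ (Subring.mul_mem _ h2int hr) hu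
  have h2ru_le : valuation F (2 * r - u) ≤ 1 := (Valuation.mem_integer_iff _ _).1 h2ru_int
  rcases h2ru_le.lt_or_eq with hsmall | hsimple
  · -- inseparable approximate root: shift to `(u₁, w₁) = (u − 2r, w + ur − r²)`
    set u₁ : F := u - 2 * r with hu₁def
    set w₁ : F := w + u * r - r ^ 2 with hw₁def
    have hu₁ : u₁ ∈ 𝒪[F] := Subring.sub_mem _ hu (Subring.mul_mem _ h2int hr)
    have hw₁ : w₁ ∈ 𝒪[F] := Subring.sub_mem _ (Subring.add_mem _ hw (Subring.mul_mem _ hu hr)) (Subring.pow_mem _ hr 2)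
    have hu₁lt : valuation F u₁ < 1 := by
      rw [hu₁def, ← Valuation.map_neg, neg_sub]; exact hsmall
    have hw₁lt : valuation F w₁ < 1 := by
      have : w₁ = -(r ^ 2 - u * r - w) := by rw [hw₁def]; ring
      rw [this, Valuation.map_neg]; exact hroot
    have hdisc : u₁ ^ 2 + 4 * w₁ = u ^ 2 + 4 * w := by rw [hu₁def, hw₁def]; ring
    -- `|w₁| ≤ |ϖ|²` would contradict the maximality of `m`
    have hw₁gt : valuation F ϖ ^ 2 < valuation F w₁ := by
      by_contra hle
      rw [not_lt] at hle
      apply hmax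
      refine ⟨a - ϖ ^ m * r, Subring.sub_mem _ ha (Subring.mul_mem _ (hϖ.pow_mem m) hr), ?_, ?_⟩
      · have : 2 * (a - ϖ ^ m * r) = ϖ ^ m * u₁ := by rw [hu₁def, mul_sub, h2a']; ring
        rw [this, map_mul, map_pow, pow_succ]
        exact mul_le_mul' le_rfl (valuation_le_uniformizer_of_lt_one hϖ hu₁ hu₁lt)
      · have : (a - ϖ ^ m * r) ^ 2 - D = -(ϖ ^ (2 * m) * w₁) := by
          have e1 : (a - ϖ ^ m * r) ^ 2 - D = (a ^ 2 - D) - (2 * a) * (ϖ ^ m * r) + (ϖ ^ m * r) ^ 2 := by ring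
          rw [e1, haD', h2a', hw₁def]; ring
        rw [this, Valuation.map_neg, map_mul, map_pow, show 2 * (m + 1) = 2 * m + 2 by ring, pow_add]
        exact mul_le_mul' le_rfl hle
    have hw₁eq : valuation F w₁ = valuation F ϖ := valuation_eq_uniformizer_of_lt_one_of_sq_lt hϖ hw₁ hw₁lt hw₁gt
    refine ⟨u₁, w₁, ϖ ^ m / 2, hz, by rw [hdisc]; exact hmain, hu₁, Or.inr ⟨hu₁lt, hw₁eq⟩⟩
  · -- simple approximate root: Hensel makes `D` a square — excluded
    exact absurd (isSquare_of_approxRoot_of_valuation_eq_one (ϖ := ϖ) h2 hu hw huw hr hroot hsimple) hns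

end UnitCase

/-! ## §3 The datum of an arbitrary non-square -/

section Main

variable {F : Type*} [Field F] [ValuativeRel F] {ϖ : F}

/-- **EVERY NON-SQUARE HAS AN INERT OR EISENSTEIN DATUM (any residue characteristic).**  Let `F` carry a valuative relation whose valuation ring `𝒪` is a Henselian
discrete valuation ring with uniformizing element `ϖ`, `char F ≠ 2`.  For every `D ≠ 0` which is not a square there are `u w z ∈ F`, `z ≠ 0`, with **`(u² + 4w)·z² = D`**,
`u ∈ 𝒪`, and EITHER `(u, w)` INERT — `w ∈ 𝒪` and the norm form `c² + ceu − e²w` of `τ² = uτ + w` is anisotropic modulo `𝔭` (`F(√D)` unramified, `𝒪[τ]` its valuation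
ring) — OR `(u, w)` EISENSTEIN — `|u| < 1`, `|w| = |ϖ|` (`F(√D)` ramified, `τ` a uniformiser).  Exactly the data of ★ `SLTwoTreeEllipticFixedBallTorusForm` ∕ ★
`SLTwoTreeQuadraticTorusNormalForm`. [cite: Serre1979, Ch. I §6 Prop. 17–18; Ch. III §5 Thm. 3; Ch. II §3] [cite: LabesseLanglands1979, §2 p. 8] -/
theorem exists_inert_or_eisenstein_datum [IsDiscreteValuationRing 𝒪[F]] [HenselianLocalRing 𝒪[F]] (h2 : (2 : F) ≠ 0) (hϖ : IsUniformizingElement ϖ)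
    {D : F} (hD0 : D ≠ 0) (hns : ¬ IsSquare D) :
    ∃ u w z : F, z ≠ 0 ∧ (u ^ 2 + 4 * w) * z ^ 2 = D ∧ u ∈ 𝒪[F] ∧
      ((w ∈ 𝒪[F] ∧ ∀ c e : F, c ∈ 𝒪[F] → e ∈ 𝒪[F] → valuation F (c ^ 2 + c * e * u - e ^ 2 * w) < 1 → valuation F c < 1 ∧ valuation F e < 1) ∨
        (valuation F u < 1 ∧ valuation F w = valuation F ϖ)) := by
  obtain ⟨c, hc0, hc⟩ := exists_mul_sq_valuation_normalised hϖ hD0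
  have hns' : ¬ IsSquare (D * c ^ 2) := by
    rintro ⟨s, hs⟩
    exact hns ⟨s / c, by field_simp; linear_combination hs⟩
  -- transport a datum of `D·c²` back to `D`
  have back : ∀ u w z : F, z ≠ 0 → (u ^ 2 + 4 * w) * z ^ 2 = D * c ^ 2 → (u ^ 2 + 4 * w) * (z / c) ^ 2 = D := by
    intro u w z _ h
    rw [div_pow, ← mul_div_assoc, h]; field_simp
  rcases hc with h1 | hπ
  · obtain ⟨u, w, z, hz, hmain, hu, hdat⟩ := exists_datum_of_valuation_eq_one h2 hϖ h1 hns'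
    exact ⟨u, w, z / c, div_ne_zero hz hc0, back u w z hz hmain, hu, hdat⟩
  · -- `|D c²| = |ϖ|`: the Eisenstein datum `(0, D c²)` with `z = 1∕(2c)`
    refine ⟨0, D * c ^ 2, 1 / (2 * c), div_ne_zero one_ne_zero (mul_ne_zero h2 hc0), ?_, Subring.zero_mem _, Or.inr ⟨by rw [map_zero]; exact zero_lt_one, hπ⟩⟩
    field_simp
    ring

end Main

/-! ## §4 The Henselian instance for the `ValuativeRel` valuation ring of a `v`-adic completion -/

section Adic

open IsDedekindDomain NumberField

/-- **`𝒪[K_v]` (the `ValuativeRel` valuation ring) IS HENSELIAN** for the `v`-adic completion of a number field: it coincides with Mathlib's `v.adicCompletionIntegers K`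
(★ `valuedInteger_eq_integer`), a complete discrete valuation ring. Stated as a theorem; use with `haveI`. [cite: Serre1979, Ch. II §3] -/
theorem henselianLocalRing_integer_adicCompletion (K : Type*) [Field K] [NumberField K] (v : HeightOneSpectrum (NumberField.RingOfIntegers K)) :
    HenselianLocalRing 𝒪[v.adicCompletion K] := by
  rw [← Literature.NumberTheory.Automorphic.valuedInteger_eq_integer (K := v.adicCompletion K)]
  exact inferInstanceAs (HenselianLocalRing (v.adicCompletionIntegers K))

end Adic

end Literature.NumberTheory.Automorphic.HermitianLatticeTree

end
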